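import Mathlib
import Literature.NumberTheory.LFunctions.IdealNormCount
import Literature.NumberTheory.Sieve.BatemanHorn
import Literature.NumberTheory.Sieve.PolynomialValuesSieveSequence
import HarnessLib

/-!
# Route `IsogenyRedei`, item `TypeIMainTerm` (stmt-Parity-0873): vocabulary of the proof

Route-posited objects (D-0016 `<Route>Defs` file) used by the proof files
`IsogenyRedeiTypeIMainTerm*.lean` of the Type-I main term of Bateman–Horn,
`(−1)^k ∑_{n ≤ x} ∑_{d_i ∣ f_i(n), ∏ d_i ≤ x^{1−η}} ∏ μ(d_i) log d_i ∼ C(f) x`.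
Nothing is asserted: plain definitions over Mathlib and `Literature.NumberTheory`
(`polyRootCountMod`, `rootDensity`, `idealNormCount`), the ring structure of the subset algebra,
and unfolding lemmas.

* One-dimensional engine (`a_f = μ ρ_f`, `c_K`, `H = a_f ⋆ c_K`): `moebRho`, `normCount`, `numer`.
* The subset algebra `Λ_k = ℝ[ε_1,…,ε_k]/(ε_i²)` realised as functions on the subsets of `Fin k`
  with the disjoint-union convolution (`SAlg`, a `CommRing`; `SAlg.coeff`, `SAlg.mk`, the
  generators `SAlg.lin i a b = a + b ε_i`, the `ℓ¹` norm `SAlg.norm1`).  In `Λ_k` the weight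
  `n ↦ 1 + ε_i log n` is completely multiplicative and `∏_i (μ(d_i) + ε_i μ(d_i) log d_i)` has top
  coefficient `∏_i μ(d_i) log d_i`, which is how the logarithms of the main term are carried
  through multiplicative manipulations.
* Local solution counts of the system `d_i ∣ f_i(n)`: `tupleLcm`, `sysSols`, `sysCount` (`ρ(d)`),
  `sysDensity` (`G(d) = ρ(d)/lcm d`).
* The `Λ_k`-valued arithmetic functions of the proof: `moebLin`, `cWeight`, `aFun`
  (`𝒶(m) = ∑_{d_1⋯d_k = m} G(d) ∏ (μ(d_i) + ε_i μ(d_i) log d_i)`), the completely multiplicative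
  `gcm` / `gcmAF`, `psiFun` (`ψ_i(n) = gcm_i(n)(1 + ε_i log n)`), `fFun = μ ψ_i`,
  `eFun = 𝒶 ⋆ ∏ ψ_i`, the real components `mg`, `mgl`, `compE`, `compF`, `proj0`, the prime tuples
  `dS`, and the weight `wt d = ∏ μ(d_i) log d_i`.

References: P. T. Bateman, R. A. Horn, Math. Comp. 16 (1962) §2; H. Davenport, A. Schinzel,
Illinois J. Math. 10 (1966); the dual-number device is folklore.
-/

noncomputable section

open Finset Polynomial ArithmeticFunction
open scoped ArithmeticFunction.Moebius

namespace Summit.Parity.BatemanHorn.Theorems.TypeIMainTerm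

open Literature.NumberTheory.Sieve Literature.NumberTheory.LFunctions

/-! ### The one-dimensional engine: `a_f`, `c_K`, `H` -/

/-- `a_f(n) = μ(n) ρ_f(n)` as a complex-valued arithmetic function
(`ρ_f(n) = polyRootCountMod ![f] n`). -/
def moebRho (f : ℤ[X]) : ArithmeticFunction ℂ where
  toFun n := (μ n : ℂ) * (polyRootCountMod ![f] n : ℂ)
  map_zero' := by simp

/-- Unfolding lemma for `moebRho`. -/
theorem moebRho_apply (f : ℤ[X]) (n : ℕ) :
    moebRho f n = (μ n : ℂ) * (polyRootCountMod ![f] n : ℂ) := rfl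

section NF

variable (K : Type*) [Field K] [NumberField K]

/-- `c_K(n) = #{I ⊆ 𝓞_K : N(I) = n}` as a complex-valued arithmetic function (value `0` at `n = 0`,
whereas `idealNormCount K 0 = 1`). -/
def normCount : ArithmeticFunction ℂ where
  toFun n := if n = 0 then 0 else (idealNormCount K n : ℂ)
  map_zero' := if_pos rfl

/-- Unfolding lemma for `normCount` at `n ≠ 0`. -/
theorem normCount_apply {n : ℕ} (hn : n ≠ 0) : normCount K n = (idealNormCount K n : ℂ) :=
  if_neg hn

/-- `H = a_f ⋆ c_K`. -/
def numer (f : ℤ[X]) : ArithmeticFunction ℂ := moebRho f * normCount K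

end NF

/-! ### The subset algebra `Λ_k` -/

/-- The subset algebra `Λ_k`: real functions on the subsets of `Fin k`. -/
def SAlg (k : ℕ) : Type := Finset (Fin k) → ℝ

namespace SAlg

variable {k : ℕ}

/-- Pointwise additive group structure on `Λ_k`. -/
instance : AddCommGroup (SAlg k) := inferInstanceAs (AddCommGroup (Finset (Fin k) → ℝ))
/-- Pointwise real vector space structure on `Λ_k`. -/
instance : Module ℝ (SAlg k) := inferInstanceAs (Module ℝ (Finset (Fin k) → ℝ))
/-- `Λ_k` is inhabited (by `0`). -/
instance : Inhabited (SAlg k) := ⟨0⟩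

/-- View an element of `Λ_k` as a function on subsets. -/
def coeff (x : SAlg k) (S : Finset (Fin k)) : ℝ := (show Finset (Fin k) → ℝ from x) S

/-- Build an element of `Λ_k` from a function on subsets. -/
def mk (x : Finset (Fin k) → ℝ) : SAlg k := x

/-- `coeff (mk x) S = x S`. -/
@[simp] theorem coeff_mk (x : Finset (Fin k) → ℝ) (S : Finset (Fin k)) : coeff (mk x) S = x S := rfl

/-- Two elements of `Λ_k` with the same coefficients are equal. -/
@[ext] theorem ext {x y : SAlg k} (h : ∀ S, coeff x S = coeff y S) : x = y := funext h

/-- `coeff (x + y) S = coeff x S + coeff y S`. -/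
@[simp] theorem coeff_add (x y : SAlg k) (S : Finset (Fin k)) :
    coeff (x + y) S = coeff x S + coeff y S := rfl

/-- `coeff (0 : SAlg k) S = 0`. -/
@[simp] theorem coeff_zero (S : Finset (Fin k)) : coeff (0 : SAlg k) S = 0 := rfl

/-- `coeff (-x) S = -coeff x S`. -/
@[simp] theorem coeff_neg (x : SAlg k) (S : Finset (Fin k)) : coeff (-x) S = -coeff x S := rfl

/-- `coeff (x - y) S = coeff x S - coeff y S`. -/
@[simp] theorem coeff_sub (x y : SAlg k) (S : Finset (Fin k)) :
    coeff (x - y) S = coeff x S - coeff y S := rfl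

/-- `coeff (c • x) S = c * coeff x S`. -/
@[simp] theorem coeff_smul (c : ℝ) (x : SAlg k) (S : Finset (Fin k)) :
    coeff (c • x) S = c * coeff x S := rfl

/-- `coeff` is additive over finite sums. -/
theorem coeff_finset_sum {ι : Type*} (s : Finset ι) (x : ι → SAlg k) (S : Finset (Fin k)) :
    coeff (∑ i ∈ s, x i) S = ∑ i ∈ s, coeff (x i) S := by
  classical
  induction s using Finset.induction_on with
  | empty => rfl
  | insert a s ha ih => rw [Finset.sum_insert ha, Finset.sum_insert ha, coeff_add, ih]

/-- The disjoint-union convolution product. -/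
instance : Mul (SAlg k) :=
  ⟨fun x y => mk fun S => ∑ T ∈ S.powerset, coeff x T * coeff y (S \ T)⟩

/-- The unit `δ_∅`. -/
instance : One (SAlg k) := ⟨mk fun S => if S = ∅ then 1 else 0⟩

/-- `coeff (x * y) S = ∑ T ∈ S.powerset, coeff x T * coeff y (S \ T)`. -/
theorem coeff_mul (x y : SAlg k) (S : Finset (Fin k)) :
    coeff (x * y) S = ∑ T ∈ S.powerset, coeff x T * coeff y (S \ T) := rfl

/-- `coeff (1 : SAlg k) S = if S = ∅ then 1 else 0`. -/
theorem coeff_one (S : Finset (Fin k)) : coeff (1 : SAlg k) S = if S = ∅ then 1 else 0 := rfl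

/-- Associativity of the disjoint-union convolution. -/
theorem mul_assoc' (x y z : SAlg k) : x * y * z = x * (y * z) := by
  ext S
  simp only [coeff_mul, Finset.sum_mul, Finset.mul_sum]
  rw [Finset.sum_sigma', Finset.sum_sigma']
  refine Finset.sum_nbij' (fun p => ⟨p.2, p.1 \ p.2⟩) (fun q => ⟨q.1 ∪ q.2, q.1⟩) ?_ ?_ ?_ ?_ ?_
  · rintro ⟨T, U⟩ h
    simp only [Finset.mem_sigma, Finset.mem_powerset] at h ⊢
    exact ⟨h.2.trans h.1, sdiff_subset_sdiff h.1 le_rfl⟩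
  · rintro ⟨U, V⟩ h
    simp only [Finset.mem_sigma, Finset.mem_powerset] at h ⊢
    refine ⟨Finset.union_subset h.1 (h.2.trans sdiff_subset), subset_union_left⟩
  · rintro ⟨T, U⟩ h
    simp only [Finset.mem_sigma, Finset.mem_powerset] at h
    simp only [Finset.union_sdiff_of_subset h.2]
  · rintro ⟨U, V⟩ h
    simp only [Finset.mem_sigma, Finset.mem_powerset] at h
    have hdisj : Disjoint U V := Finset.disjoint_of_subset_right h.2 disjoint_sdiff
    simp only [Finset.union_sdiff_left, Finset.sdiff_eq_self_of_disjoint hdisj.symm]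
  · rintro ⟨T, U⟩ h
    simp only [Finset.mem_sigma, Finset.mem_powerset] at h
    have hset : (S \ U) \ (T \ U) = S \ T := by
      ext i
      simp only [Finset.mem_sdiff]
      constructor
      · rintro ⟨⟨hiS, hiU⟩, hiTU⟩
        exact ⟨hiS, fun hiT => hiTU ⟨hiT, hiU⟩⟩
      · rintro ⟨hiS, hiT⟩
        exact ⟨⟨hiS, fun hiU => hiT (h.2 hiU)⟩, fun hTU => hiT hTU.1⟩
    simp only [hset, mul_assoc]


/-- Commutativity (reindex `T ↦ S ∖ T`). -/
theorem mul_comm' (x y : SAlg k) : x * y = y * x := by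
  ext S
  simp only [coeff_mul]
  refine Finset.sum_nbij' (fun T => S \ T) (fun T => S \ T) ?_ ?_ ?_ ?_ ?_
  · intro T _; exact Finset.mem_powerset.mpr sdiff_subset
  · intro T _; exact Finset.mem_powerset.mpr sdiff_subset
  · intro T hT; exact Finset.sdiff_sdiff_eq_self (Finset.mem_powerset.mp hT)
  · intro T hT; exact Finset.sdiff_sdiff_eq_self (Finset.mem_powerset.mp hT)
  · intro T hT
    rw [Finset.sdiff_sdiff_eq_self (Finset.mem_powerset.mp hT), mul_comm]

/-- `1 * x = x`. -/
theorem one_mul' (x : SAlg k) : 1 * x = x := by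
  ext S
  rw [coeff_mul, Finset.sum_eq_single ∅]
  · simp [coeff_one]
  · intro T _ hT; simp [coeff_one, hT]
  · intro h; exact absurd (Finset.empty_mem_powerset S) h

/-- `x * (y + z) = x * y + x * z`. -/
theorem left_distrib' (x y z : SAlg k) : x * (y + z) = x * y + x * z := by
  ext S; simp [coeff_mul, mul_add, Finset.sum_add_distrib]

/-- `(0 : SAlg k) * x = 0`. -/
theorem zero_mul' (x : SAlg k) : (0 : SAlg k) * x = 0 := by
  ext S; simp [coeff_mul]

/-- `Λ_k` is a commutative ring under the disjoint-union convolution (the ring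
`ℝ[ε_1,…,ε_k]/(ε_i²)`). -/
instance : CommRing (SAlg k) :=
  { (inferInstance : AddCommGroup (SAlg k)) with
    mul := (· * ·)
    one := 1
    mul_assoc := mul_assoc'
    one_mul := one_mul'
    mul_one := fun x => by rw [mul_comm', one_mul']
    mul_comm := mul_comm'
    left_distrib := left_distrib'
    right_distrib := fun x y z => by rw [mul_comm', left_distrib', mul_comm' x, mul_comm' y]
    zero_mul := zero_mul'
    mul_zero := fun x => by rw [mul_comm', zero_mul']
    npow := fun n x => npowRec n x }

/-- `lin i a b = a + b ε_i`: value `a` at `∅`, `b` at `{i}`, `0` elsewhere. -/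
def lin (i : Fin k) (a b : ℝ) : SAlg k :=
  mk fun S => if S = ∅ then a else if S = {i} then b else 0

/-- `coeff (lin i a b) S = if S = ∅ then a else if S = {i} then b else 0`. -/
theorem coeff_lin (i : Fin k) (a b : ℝ) (S : Finset (Fin k)) :
    coeff (lin i a b) S = if S = ∅ then a else if S = {i} then b else 0 := rfl

/-- `norm1 x = ∑_S |x(S)|`. -/
def norm1 (x : SAlg k) : ℝ := ∑ S : Finset (Fin k), |coeff x S|

end SAlg

/-! ### Local solution counts -/

variable {k : ℕ}

/-- `lcm_i d_i`. -/
def tupleLcm (d : Fin k → ℕ) : ℕ := Finset.univ.lcm d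

/-- The solutions of the simultaneous congruences `d_i ∣ f_i(n)` (`i < k`) inside `s`. -/
def sysSols (f : Fin k → ℤ[X]) (d : Fin k → ℕ) (s : Finset ℕ) : Finset ℕ :=
  s.filter fun n => ∀ i, ((d i : ℕ) : ℤ) ∣ (f i).eval (n : ℤ)

/-- `ρ(d) = #{n < lcm d : d_i ∣ f_i(n) ∀ i}`. -/
def sysCount (f : Fin k → ℤ[X]) (d : Fin k → ℕ) : ℕ := (sysSols f d (Finset.range (tupleLcm d))).card

variable (f : Fin k → ℤ[X])

/-- `G(d) = ρ(d)/lcm(d)`, the density of `{n : d_i ∣ f_i(n) ∀ i}`. -/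
def sysDensity (d : Fin k → ℕ) : ℝ := (sysCount f d : ℝ) / (tupleLcm d : ℝ)

/-- The generator attached to the coordinate `i` and the modulus `d`: `μ(d) + ε_i μ(d) log d`. -/
def moebLin (i : Fin k) (d : ℕ) : SAlg k := SAlg.lin i (μ d : ℝ) ((μ d : ℝ) * Real.log d)

/-- `cWeight f d = G(d) · ∏_i (μ(d_i) + ε_i μ(d_i) log d_i)`. -/
def cWeight (d : Fin k → ℕ) : SAlg k := sysDensity f d • ∏ i, moebLin i (d i)

/-- `𝒶(m) = ∑_{d_1 ⋯ d_k = m} cWeight f d`. -/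
def aFun : ArithmeticFunction (SAlg k) :=
  ⟨fun m => ∑ d ∈ Nat.finMulAntidiag k m, cWeight f d, by simp⟩

/-- `aFun f m = ∑ d ∈ Nat.finMulAntidiag k m, cWeight f d`. -/
theorem aFun_apply (m : ℕ) : aFun f m = ∑ d ∈ Nat.finMulAntidiag k m, cWeight f d := rfl

/-! ### `gcm`, `ψ_i`, `𝒻_i`, `𝓮` -/

/-- `gcm f i n = ∏_{p^v ∥ n} g_i(p)^v` (`g_i(p) = rootDensity (f i) p`), with `gcm f i 0 = 0`. -/
def gcm (i : Fin k) (n : ℕ) : ℝ :=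
  if n = 0 then 0 else n.factorization.prod fun p v => rootDensity (f i) p ^ v

/-- `gcm f i 0 = 0`. -/
theorem gcm_zero (i : Fin k) : gcm f i 0 = 0 := if_pos rfl

/-- `gcm f i n = n.factorization.prod fun p v => rootDensity (f i) p ^ v`. -/
theorem gcm_of_ne_zero (i : Fin k) {n : ℕ} (hn : n ≠ 0) :
    gcm f i n = n.factorization.prod fun p v => rootDensity (f i) p ^ v := if_neg hn

/-- `ψ_i(n) = gcm_i(n) (1 + ε_i log n)`, `ψ_i(0) = 0`. -/
def psiFun (i : Fin k) : ArithmeticFunction (SAlg k) :=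
  ⟨fun n => gcm f i n • SAlg.lin i 1 (Real.log n), by simp [gcm_zero]⟩

/-- `psiFun f i n = gcm f i n • SAlg.lin i 1 (Real.log n)`. -/
theorem psiFun_apply (i : Fin k) (n : ℕ) : psiFun f i n = gcm f i n • SAlg.lin i 1 (Real.log n) :=
  rfl

/-- `𝒻_i(n) = μ(n) ψ_i(n)`. -/
def fFun (i : Fin k) : ArithmeticFunction (SAlg k) :=
  ⟨fun n => (μ n : ℝ) • psiFun f i n, by simp⟩

/-- `fFun f i n = (μ n : ℝ) • psiFun f i n`. -/
theorem fFun_apply (i : Fin k) (n : ℕ) : fFun f i n = (μ n : ℝ) • psiFun f i n := rfl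

/-- `𝓮 = 𝒶 ⋆ ∏_i ψ_i`. -/
def eFun : ArithmeticFunction (SAlg k) := aFun f * ∏ i, psiFun f i

/-! ### Real components -/

/-- `mg f i (n) = μ(n) g_i(n)`. -/
def mg (i : Fin k) : ArithmeticFunction ℝ :=
  ⟨fun n => (μ n : ℝ) * rootDensity (f i) n, by simp⟩

/-- `mgl f i (n) = μ(n) g_i(n) log n`. -/
def mgl (i : Fin k) : ArithmeticFunction ℝ :=
  ⟨fun n => (μ n : ℝ) * rootDensity (f i) n * Real.log n, by simp⟩

/-- `mg f i n = (μ n : ℝ) * rootDensity (f i) n`. -/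
theorem mg_apply (i : Fin k) (n : ℕ) : mg f i n = (μ n : ℝ) * rootDensity (f i) n := rfl

/-- `mgl f i n = (μ n : ℝ) * rootDensity (f i) n * Real.log n`. -/
theorem mgl_apply (i : Fin k) (n : ℕ) : mgl f i n = (μ n : ℝ) * rootDensity (f i) n * Real.log n :=
  rfl

/-- `E_J(n) = [ε_{univ ∖ J}] 𝓮(n)`. -/
def compE (J : Finset (Fin k)) : ArithmeticFunction ℝ :=
  ⟨fun n => SAlg.coeff (eFun f n) (Finset.univ \ J), by
    rw [ArithmeticFunction.map_zero, SAlg.coeff_zero]⟩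

/-- `compE f J n = SAlg.coeff (eFun f n) (Finset.univ \ J)`. -/
theorem compE_apply (J : Finset (Fin k)) (n : ℕ) :
    compE f J n = SAlg.coeff (eFun f n) (Finset.univ \ J) := rfl

/-- `F_J = ∏_i (mgl_i if i ∈ J else mg_i)`. -/
def compF (J : Finset (Fin k)) : ArithmeticFunction ℝ :=
  ∏ i, if i ∈ J then mgl f i else mg f i

/-- `proj0 F (n) = [ε_∅] F(n)`. -/
def proj0 (F : ArithmeticFunction (SAlg k)) : ArithmeticFunction ℝ :=
  ⟨fun n => SAlg.coeff (F n) ∅, by rw [ArithmeticFunction.map_zero, SAlg.coeff_zero]⟩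

/-- `proj0 F n = SAlg.coeff (F n) ∅`. -/
theorem proj0_apply (F : ArithmeticFunction (SAlg k)) (n : ℕ) : proj0 F n = SAlg.coeff (F n) ∅ := rfl

/-- `gcm` as a real arithmetic function. -/
def gcmAF (i : Fin k) : ArithmeticFunction ℝ := ⟨gcm f i, gcm_zero f i⟩

/-- `gcmAF f i n = gcm f i n`. -/
theorem gcmAF_apply (i : Fin k) (n : ℕ) : gcmAF f i n = gcm f i n := rfl

/-- `dS p S = (p if i ∈ S else 1)_i`. -/
def dS (p : ℕ) (S : Finset (Fin k)) : Fin k → ℕ := fun i => if i ∈ S then p else 1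

/-- `dS p S i = if i ∈ S then p else 1`. -/
theorem dS_apply (p : ℕ) (S : Finset (Fin k)) (i : Fin k) : dS p S i = if i ∈ S then p else 1 := rfl

/-- The log-Möbius weight `w(d) = ∏ μ(d_i) log d_i`. -/
def wt (d : Fin k → ℕ) : ℝ := ∏ i, ((μ (d i) : ℝ) * Real.log (d i))

/-- `wt d = ∏ i, ((μ (d i) : ℝ) * Real.log (d i))`. -/
theorem wt_apply (d : Fin k → ℕ) : wt d = ∏ i, ((μ (d i) : ℝ) * Real.log (d i)) := rfl

end Summit.Parity.BatemanHorn.Theorems.TypeIMainTerm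

end
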